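import Mathlib
import Summits.Ventures.PercRepro2.CoinChainXASixTopGate
import Summits.Ventures.PercRepro2.CoinChainXAClosedGateSums
import Summits.Ventures.PercRepro2.CoinChainXAClosedGateGenSums

/-!
# The `JG` fact: the coin-killed `y`-marked clusters against the `j`-gate
(blind cell PercRepro2, night-2 g32; proofs/NIGHT2-DARC.md §73.7g)

`cg_fact_JG`: `YJ·(XU + XM) ≤ (a + δ)·(XYU + XYM)` — the killed law `ν(c − d)·y` on the coin-entered clusters against the
gate `νd·x` on all `j`-marked clusters: a four-functions instance with the `m`-free clusters as the first and the meet
region (`PA = PM = {m ∉ W}`), the whole lattice as the second and the join region, laws `L₁ = ν·κ·y`, `L₂ = νd·x`,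
`L₃ = ν·κ̃`, `L₄ = νd·xy` with `κ = κ̃ = (c − d on the clusters meeting ent′, c elsewhere)` the piecewise killed law
(`cg_piece_pw`); the sums are `YJ` (`cg_entfree_piecewise`) and `a + δ` (`cg_entfree_piecewise'`).
-/

namespace Summit.Ventures.PercRepro2.Coin

open Classical

section JGFact

variable {V : Type*} [DecidableEq V] {R : Type*} [Field R] [LinearOrder R] [IsStrictOrderedRing R]

/-- **The `JG` fact** `YJ·(XU + XM) ≤ (a + δ)·(XYU + XYM)`. -/
theorem cg_fact_JG (U : Finset V) (m : V) (ent' : Finset V) (ν c d : Finset V → R)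
    (hν0 : ∀ W, 0 ≤ ν W) (hν : ∀ s ⊆ U, ∀ t ⊆ U, ν s * ν t ≤ ν (s ∩ t) * ν (s ∪ t))
    (hc0 : ∀ W, 0 ≤ c W) (hd0 : ∀ W, 0 ≤ d W) (hdc : ∀ W, d W ≤ c W)
    (hcd : ∀ s t, c s * d t ≤ c (s ∩ t) * d (s ∪ t)) (hratio : ∀ s t, s ⊆ t → d s * c t ≤ c s * d t)
    (x y : Finset V → R) (hx0 : ∀ W, 0 ≤ x W) (hy0 : ∀ W, 0 ≤ y W)
    (hxm : ∀ s t, x s ≤ x (s ∪ t)) (hym : ∀ s t, y s ≤ y (s ∪ t))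
    (hxI : ∀ W, (¬ ∃ r ∈ ({m} : Finset V) ∪ ent', r ∈ W) → x W = 0)
    (hyI : ∀ W, (¬ ∃ r ∈ ({m} : Finset V) ∪ ent', r ∈ W) → y W = 0) :
    (∑ W ∈ U.powerset.filter (fun W => (¬ ∃ r ∈ ({m} : Finset V), r ∈ W) ∧ ∃ r ∈ ent', r ∈ W), ν W * (c W - d W) * y W) * ((∑ W ∈ U.powerset.filter (fun W => (¬ ∃ r ∈ ({m} : Finset V), r ∈ W) ∧ ∃ r ∈ ent', r ∈ W), ν W * d W * x W) + (∑ W ∈ U.powerset.filter (fun W => ∃ r ∈ ({m} : Finset V), r ∈ W), ν W * d W * x W)) ≤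
    ((∑ W ∈ U.powerset.filter (fun W => ¬ ∃ r ∈ ({m} : Finset V) ∪ ent', r ∈ W), ν W * c W) + (∑ W ∈ U.powerset.filter (fun W => (¬ ∃ r ∈ ({m} : Finset V), r ∈ W) ∧ ∃ r ∈ ent', r ∈ W), ν W * (c W - d W)))
      * ((∑ W ∈ U.powerset.filter (fun W => (¬ ∃ r ∈ ({m} : Finset V), r ∈ W) ∧ ∃ r ∈ ent', r ∈ W), ν W * d W * (x W * y W)) + (∑ W ∈ U.powerset.filter (fun W => ∃ r ∈ ({m} : Finset V), r ∈ W), ν W * d W * (x W * y W))) := by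
  set κ : Finset V → R := fun W => if ∃ r ∈ ent', r ∈ W then c W - d W else c W with hκ
  have hcd0 : ∀ W, 0 ≤ c W - d W := fun W => by linarith [hdc W]
  have hκ0 : ∀ W, 0 ≤ κ W := fun W => by simp only [hκ]; split_ifs <;> [exact hcd0 W; exact hc0 W]
  have key := ad_sets_dec U (fun W => ν W * κ W * y W) (fun W => ν W * d W * x W) (fun W => ν W * κ W)
    (fun W => ν W * d W * (x W * y W))
    (fun W => mul_nonneg (mul_nonneg (hν0 W) (hκ0 W)) (hy0 W)) (fun W => mul_nonneg (mul_nonneg (hν0 W) (hd0 W)) (hx0 W))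
    (fun W => mul_nonneg (hν0 W) (hκ0 W)) (fun W => mul_nonneg (mul_nonneg (hν0 W) (hd0 W)) (mul_nonneg (hx0 W) (hy0 W)))
    (fun W => ¬ ∃ r ∈ ({m} : Finset V), r ∈ W) (fun _ => True) (fun W => ¬ ∃ r ∈ ({m} : Finset V), r ∈ W) (fun _ => True) (by
      intro s hs t ht hA _
      refine ⟨fun ⟨r, hr, hrW⟩ => hA ⟨r, hr, (Finset.mem_inter.1 hrW).1⟩, trivial, ?_⟩
      have hxt : x t ≤ x (s ∪ t) := by rw [Finset.union_comm]; exact hxm t s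
      have hys : y s ≤ y (s ∪ t) := hym s t
      have hlaw : κ s * d t ≤ κ (s ∩ t) * d (s ∪ t) := by
        simp only [hκ]; exact cg_piece_pw ent' c d hc0 hd0 hdc hcd hratio s t
      calc ν s * κ s * y s * (ν t * d t * x t) = (ν s * ν t) * (κ s * d t) * (x t * y s) := by ring
        _ ≤ (ν (s ∩ t) * ν (s ∪ t)) * (κ (s ∩ t) * d (s ∪ t)) * (x (s ∪ t) * y (s ∪ t)) :=
            mul_le_mul (mul_le_mul (hν s hs t ht) hlaw (mul_nonneg (hκ0 s) (hd0 t)) (mul_nonneg (hν0 _) (hν0 _)))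
              (mul_le_mul hxt hys (hy0 s) (hx0 _)) (mul_nonneg (hx0 t) (hy0 s))
              (mul_nonneg (mul_nonneg (hν0 _) (hν0 _)) (mul_nonneg (hκ0 _) (hd0 _)))
        _ = ν (s ∩ t) * κ (s ∩ t) * (ν (s ∪ t) * d (s ∪ t) * (x (s ∪ t) * y (s ∪ t))) := by ring)
  simp only [Finset.filter_true] at key
  rw [sum_three_regions U {m} ent' (fun W => ν W * d W * x W), sum_three_regions U {m} ent' (fun W => ν W * d W * (x W * y W))] at key
  have hI2 : (∑ W ∈ U.powerset.filter (fun W => ¬ ∃ r ∈ ({m} : Finset V) ∪ ent', r ∈ W), ν W * d W * x W) = 0 :=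
    cgate_sum_zero U _ _ (fun W hW => by rw [hxI W hW, mul_zero])
  have hI4 : (∑ W ∈ U.powerset.filter (fun W => ¬ ∃ r ∈ ({m} : Finset V) ∪ ent', r ∈ W), ν W * d W * (x W * y W)) = 0 :=
    cgate_sum_zero U _ _ (fun W hW => by rw [hxI W hW, zero_mul, mul_zero])
  have hIy : (∑ W ∈ U.powerset.filter (fun W => ¬ ∃ r ∈ ({m} : Finset V) ∪ ent', r ∈ W), ν W * c W * y W) = 0 :=
    cgate_sum_zero U _ _ (fun W hW => by rw [hyI W hW, mul_zero])
  have e1 : (∑ W ∈ U.powerset.filter (fun W => ¬ ∃ r ∈ ({m} : Finset V), r ∈ W), ν W * κ W * y W)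
      = ∑ W ∈ U.powerset.filter (fun W => ¬ ∃ r ∈ ({m} : Finset V), r ∈ W), ν W * (if ∃ r ∈ ent', r ∈ W then c W - d W else c W) * y W :=
    Finset.sum_congr rfl (fun W _ => by simp only [hκ])
  have e3 : (∑ W ∈ U.powerset.filter (fun W => ¬ ∃ r ∈ ({m} : Finset V), r ∈ W), ν W * κ W)
      = ∑ W ∈ U.powerset.filter (fun W => ¬ ∃ r ∈ ({m} : Finset V), r ∈ W), ν W * (if ∃ r ∈ ent', r ∈ W then c W - d W else c W) :=
    Finset.sum_congr rfl (fun W _ => by simp only [hκ])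
  rw [e1, e3, cg_entfree_piecewise U {m} ent' ν c d y, cg_entfree_piecewise' U {m} ent' ν c d, hIy, hI2, hI4, zero_add, zero_add, zero_add] at key
  linear_combination key

end JGFact

end Summit.Ventures.PercRepro2.Coin
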